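import Literature.Barriers.FinalStateConjecture.TrappingDerivativeLossEnergy
import Literature.Geometry.Lorentzian.KerrSchildWaveCauchyProblemProofs
import HarnessLib

/-!
# Discharges of named facts of `TrappingDerivativeLossInputs.lean`

`Literature/Barriers/FinalStateConjecture/TrappingDerivativeLossInputsHolds.lean` —
proofs-only sibling of `TrappingDerivativeLossInputs.lean` (no definitions, no named facts).
Each theorem below closes a named fact `X : Prop` of that file as `X_holds : X` by composing
an ACCEPTED reduction theorem of the tree with the ACCEPTED unconditional `_holds` discharges
of all of its hypotheses; nothing is re-proved and no statement is changed. Recorded by the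
librarian sweep g25 (2026-08-16, pass 5c: facts dischargeable in one line from the tree's own
lemmas), so that the facts census, `#h21_route_deps` and the cone guardrail see these facts as
theorems.

Discharged here:

* `KerrWaveCauchyEnergyEstimate_holds` := `of_waveCauchyProblem` `waveCauchyProblem_holds`
  (`TrappingDerivativeLossEnergy.lean`).

## References

* [Sbierski2015] — see `lean/references.bib` and the docstring of the fact in `TrappingDerivativeLossInputs.lean`.
-/

namespace Literature.Barriers.FinalStateConjecture

/-- **Discharge of the named fact `KerrWaveCauchyEnergyEstimate`**
(`TrappingDerivativeLossInputs.lean`): (A) The Cauchy problem and the energy estimate for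
`□_g` on the Kerr exterior (named fact; the well-posedness input of Sbierski's Thm. 2.1).
Sbierski, Anal. PDE 8 (2015), proof of Thm. 2.1: with `v` "the solution of the following
initial value problem: … — obtained as `of_waveCauchyProblem` applied to the tree's
unconditional discharge `waveCauchyProblem_holds` of its hypothesis (reduction in
`TrappingDerivativeLossEnergy.lean`).
[cite: Sbierski2015, §2 proof of Thm. 2.1 (energy estimate) with Thm. 7.4; BarGinouxPfaffle2007 Ch. 3 Sect. 2 Thm. 2.9] -/
theorem KerrWaveCauchyEnergyEstimate_holds :
    KerrWaveCauchyEnergyEstimate :=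
  Literature.Barriers.FinalStateConjecture.KerrWaveCauchyEnergyEstimate.of_waveCauchyProblem
    Literature.Geometry.Lorentzian.KerrSchild.waveCauchyProblem_holds

end Literature.Barriers.FinalStateConjecture
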